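import Summits.BirchSwinnertonDyer.BirchSwinnertonDyer.Theorems.ErratumRoadFiveNonSurjCornerKolyJWalkCebotarev
import Summits.BirchSwinnertonDyer.BirchSwinnertonDyer.Theorems.ClassRecordThreeCornerAtThreeKolyImageCebotarevShift
import Summits.BirchSwinnertonDyer.BirchSwinnertonDyer.Theorems.ClassRecordThreeCornerAtThreeKolyImageInputsInert
import HarnessLib

/-!
# PORT-SPEC (P1), file 6: the ČEBOTAREV input of the family swap in GROSS's currency — McCallum Cor. 3.2 ∕ Jetchev Lemma 5.1
# for a PAIR of opposite `τ`-eigenclasses, output prime `ℓ` with `IsKolyvaginPrime N W K p ℓ ∧ FrobEqFrobInfty W K (p^{k+j}) ℓ`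
# (Gross (3.2) depth `≥ k + j`), from ANY system-shaped supply; KERNEL instances for `ρ̄_{E,p}` onto and for `E[p]` irreducible with
# `−1 ∈ ρ̄(Γ_ℚ)` (cell `bsd-stepL`, seat `bsd-stepL-corner-p1` g15; `--supports stmt-BirchSwinnertonDyer-21420 --as helper`)

WHY. File 5 (`…ShimuraSwapFamilySupply`) derives the port target `ShimuraWalk.SwapSupplyAt hK ι W N p ys` from, among others, a
Čebotarev supply `hceb` in Gross's currency (the walk's target is Gross's depth `frobDepth`, not W. Zhang's numeric index). The tree's
pair-form wrappers (`Koly.exists_kolyvaginPrime_addOrderOf_localization_eq_shift[_of_irr_of_neg]`, tam3-p1 ∕ this seat g7) convert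
the kernel's `FrobEqFrobInfty W K (p^{k+j}) ℓ` into Zhang's index and DROP it. THIS FILE keeps it: §1 `exists_prime_addOrderOf_localization_eq_of_systemSupply`
— the pair form from ANY McCallum-Cor.-3.2-shaped supply for independent systems `cs : Fin r → H¹(K, E[p^k])` with an ARBITRARY output
predicate `P` (the bookkeeping of the two wrappers, written once: orders are powers of `p`, the `torsionLocalKer` dictionary, the
independence of opposite eigenclasses `JET.dvd_of_zsmul_add_zsmul_eq_zero_of_eigen`); §2 the two KERNEL instances with
`P ℓ := IsKolyvaginPrime N W K p ℓ ∧ FrobEqFrobInfty W K (p^{k+j}) ℓ` — `ρ̄` onto (shim-p1's `McCallum1991_cor_3_2_pow_shift_of_chebotarev`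
with `chebotarev_artinRep_holds`, `exists_weilPairing_holds`) and `E[p]` irreducible with `−1 ∈ ρ̄(Γ_ℚ)` + Gross's disjointness prime
(`McCallum1991_cor_3_2_pow_shift_of_irr_of_neg`, this seat g7); §3 the same two in EXACTLY the shape of file 5's binder `hceb`
(level `p`, shift `1 + j`, every non-trivial `τ`). HONEST FRAMING: theorems only, no definition ∕ fact ∕ sorry; §1 CONDITIONAL on the
displayed supply, §2–§3 UNCONDITIONAL (Čebotarev and the Weil pairing are tree theorems); the inert-`3` irreducible frames of crux
21420 are NOT covered by §2 (their Čebotarev input is lane B's); nothing about any curve; no stub ∕ item closes; BSD is not proved by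
any of this; T7. Credit: tam3-p1 (pair-form bookkeeping), shim-p1 ∕ shim3a (kernel), bsd-jet.
References (locators only): [cite: McCallumLMS1991, §3 Cor. 3.2 (p. 299), §4 Lemma 4.6] [cite: Jetchev2008, Lemma 5.1 (p. 821), Rem. 6.2]
[cite: GrossLMS1991, §3 (3.1)–(3.3)] [cite: MatarNekovar2019, Prop. 5.26 (2)].
presearch: not applicable (re-keying of tree theorems). Design: theorems only; `K : Type`. Axioms: `propext`, `Classical.choice`, `Quot.sound`.
-/

set_option autoImplicit false

noncomputable section

open scoped Classical NumberField

namespace Summit.BirchSwinnertonDyer.Rank1Residual.X11b.Three.Koly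

open WeierstrassCurve IsDedekindDomain NumberField Literature.NumberTheory.EllipticCurves
  Literature.NumberTheory.EllipticCurves.ModularForms Literature.NumberTheory.GaloisRepresentations
  Summit.BirchSwinnertonDyer.BirchSwinnertonDyer.Theorems

variable (W : WeierstrassCurve ℚ) [W.IsElliptic] {K : Type} [Field K] [NumberField K]

/-! ### §1 The pair form from a system-shaped supply, arbitrary output predicate -/

/-- **[J] Lemma 5.1 ∕ McCallum Cor. 3.2 DECOUPLED for a pair of opposite eigenclasses, from ANY system-shaped supply.** For `p` odd,
`τ ∈ Aut(K/ℚ)`, a level `k ≥ 1`, a predicate `P` on primes and a supply `hsys` «for every finite independent system of non-zero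
`τ`-eigenclasses in `H¹(K, E[p^k])` with exponents, primes `ℓ` beyond any bound with `P ℓ` and the prescribed local orders at `λ ∋ ℓ`»:
for eigenclasses `x` (sign `e`) and `y ≠ 0` (sign `−e`) and any bound `b`, a prime `ℓ > b` with `P ℓ` whose localisation preserves the
orders of `x` and `y`. [cite: Jetchev2008, Lemma 5.1 (p. 821)] [cite: McCallumLMS1991, §3 Cor. 3.2 (p. 299)] -/
theorem exists_prime_addOrderOf_localization_eq_of_systemSupply
    {p : ℕ} [Fact p.Prime] (hp2 : p ≠ 2) (τ : K ≃ₐ[ℚ] K) {k : ℕ} (P : ℕ → Prop)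
    (hsys : ∀ {r : ℕ} (cs : Fin r → galH1Torsion (W.baseChange K) ((p ^ k : ℕ) : ℤ)), (∀ i, cs i ≠ 0) →
      ∀ (Nv : Fin r → ℕ), (∀ i, Nv i ≠ 0 → ((p : ℤ) ^ (Nv i - 1)) • cs i ≠ 0) →
      (∀ i, ∃ e : ℤ, (e = 1 ∨ e = -1) ∧ conjAct W τ ((p ^ k : ℕ) : ℤ) (cs i) = e • cs i) →
      (∀ a : Fin r → ℤ, ∑ i, a i • cs i = 0 → ∀ i, a i • cs i = 0) → ∀ (b : ℕ),
      ∃ ℓ : ℕ, b < ℓ ∧ P ℓ ∧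
        ∀ i, ∀ v : HeightOneSpectrum (𝓞 K), (ℓ : 𝓞 K) ∈ v.asIdeal →
          (((p : ℤ) ^ Nv i) • cs i ∈
              (W.baseChange K).torsionLocalKer (v.adicCompletion K) ((p ^ k : ℕ) : ℤ) ∧
            (Nv i ≠ 0 → ((p : ℤ) ^ (Nv i - 1)) • cs i ∉
              (W.baseChange K).torsionLocalKer (v.adicCompletion K) ((p ^ k : ℕ) : ℤ))))
    {e : ℤ} (he : e = 1 ∨ e = -1)
    (x y : galH1Torsion (W.baseChange K) ((p ^ k : ℕ) : ℤ))
    (hx : conjAct W τ ((p ^ k : ℕ) : ℤ) x = e • x) (hy : conjAct W τ ((p ^ k : ℕ) : ℤ) y = (-e) • y)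
    (hy0 : y ≠ 0) (b : ℕ) :
    ∃ ℓ : ℕ, b < ℓ ∧ P ℓ ∧
      ∀ v : HeightOneSpectrum (𝓞 K), (ℓ : 𝓞 K) ∈ v.asIdeal →
        addOrderOf (galoisCohomology.localization
            ((W.baseChange K).torsionGaloisModule ((p ^ k : ℕ) : ℤ)) (Sum.inr v) 1 x) = addOrderOf x ∧
        addOrderOf (galoisCohomology.localization
            ((W.baseChange K).torsionGaloisModule ((p ^ k : ℕ) : ℤ)) (Sum.inr v) 1 y) = addOrderOf y := by
  have hp : p.Prime := Fact.out
  -- every class is killed by `p^k`, so orders are powers of `p` (and prime to `2`)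
  have hkill : ∀ z : galH1Torsion (W.baseChange K) ((p ^ k : ℕ) : ℤ), p ^ k • z = 0 := fun z ↦
    galoisCohomology.nsmul_eq_zero_of_forall ((W.baseChange K).torsionGaloisModule ((p ^ k : ℕ) : ℤ))
      (fun T ↦ by
        have h := (W.baseChange K).natAbs_nsmul_geomTorsion T
        rwa [Int.natAbs_natCast] at h) z
  have hordpow : ∀ z : galH1Torsion (W.baseChange K) ((p ^ k : ℕ) : ℤ), ∃ a ≤ k, addOrderOf z = p ^ a :=
    fun z ↦ (Nat.dvd_prime_pow hp).mp (addOrderOf_dvd_of_nsmul_eq_zero (hkill z))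
  have hcop2 : ∀ z : galH1Torsion (W.baseChange K) ((p ^ k : ℕ) : ℤ), (addOrderOf z).Coprime 2 := by
    intro z
    obtain ⟨a, -, ha⟩ := hordpow z
    rw [ha]
    exact Nat.Coprime.pow_left _ ((Nat.coprime_primes hp Nat.prime_two).mpr hp2)
  let loc : ∀ v : HeightOneSpectrum (𝓞 K), galH1Torsion (W.baseChange K) ((p ^ k : ℕ) : ℤ) →+
      galoisCohomology (((W.baseChange K).torsionGaloisModule ((p ^ k : ℕ) : ℤ)).toLocal (Sum.inr v)) 1 :=
    fun v ↦ galoisCohomology.localization ((W.baseChange K).torsionGaloisModule ((p ^ k : ℕ) : ℤ))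
      (Sum.inr v) 1
  have hloc : ∀ (v : HeightOneSpectrum (𝓞 K)) (z : galH1Torsion (W.baseChange K) ((p ^ k : ℕ) : ℤ))
      (a : ℕ), loc v (p ^ a • z) = 0 ↔
        ((p : ℤ) ^ a) • z ∈ (W.baseChange K).torsionLocalKer (v.adicCompletion K) ((p ^ k : ℕ) : ℤ) := by
    intro v z a
    haveI : CharZero (v.adicCompletion K) := charZero_of_injective_algebraMap (algebraMap K _).injective
    have hz : ((p : ℤ) ^ a) • z = p ^ a • z := by
      rw [← natCast_zsmul]; push_cast; rfl
    rw [hz, mem_torsionLocalKer_iff_res_eq_zero (W := W.baseChange K)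
      (E := v.adicCompletion K) (pow_ne_zero k hp.ne_zero)]
    exact Iff.rfl
  have hconv : ∀ (v : HeightOneSpectrum (𝓞 K)) (z : galH1Torsion (W.baseChange K) ((p ^ k : ℕ) : ℤ))
      (a : ℕ), addOrderOf z = p ^ a →
      (((p : ℤ) ^ a) • z ∈ (W.baseChange K).torsionLocalKer (v.adicCompletion K) ((p ^ k : ℕ) : ℤ) ∧
        (a ≠ 0 → ((p : ℤ) ^ (a - 1)) • z ∉
          (W.baseChange K).torsionLocalKer (v.adicCompletion K) ((p ^ k : ℕ) : ℤ))) →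
      addOrderOf (loc v z) = addOrderOf z := by
    intro v z a ha ⟨h1, h2⟩
    rw [ha]
    rcases Nat.eq_zero_or_pos a with rfl | hapos
    · have hz : z = 0 := by rw [← AddMonoid.addOrderOf_eq_one_iff, ha, pow_zero]
      rw [hz, map_zero, addOrderOf_zero, pow_zero]
    · obtain ⟨a', rfl⟩ : ∃ a', a = a' + 1 := ⟨a - 1, by omega⟩
      have hfin : p ^ (a' + 1) • loc v z = 0 := by rw [← map_nsmul]; exact (hloc v z _).mpr h1
      have hnot : ¬ p ^ a' • loc v z = 0 := by
        intro h0
        rw [← map_nsmul] at h0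
        exact h2 (by omega) (by simpa using (hloc v z a').mp h0)
      exact addOrderOf_eq_prime_pow hnot hfin
  obtain ⟨b', -, hb'⟩ := hordpow y
  have hey : (-e = 1 ∨ -e = -1) := by rcases he with rfl | rfl <;> norm_num
  have hNof : ∀ (z : galH1Torsion (W.baseChange K) ((p ^ k : ℕ) : ℤ)) (a : ℕ), addOrderOf z = p ^ a →
      a ≠ 0 → ((p : ℤ) ^ (a - 1)) • z ≠ 0 := by
    intro z a ha ha0 h0
    have hz : ((p : ℤ) ^ (a - 1)) • z = p ^ (a - 1) • z := by
      rw [← natCast_zsmul]; push_cast; rfl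
    rw [hz] at h0
    have hlt : p ^ (a - 1) < addOrderOf z := by
      rw [ha]; exact Nat.pow_lt_pow_right hp.one_lt (by omega)
    exact (nsmul_ne_zero_of_lt_addOrderOf (pow_ne_zero _ hp.ne_zero) hlt) h0
  by_cases hx0 : x = 0
  · -- the system `(y)`
    obtain ⟨ℓ, hbℓ, hPℓ, hordloc⟩ := hsys ![y]
        (by intro i; fin_cases i; exact hy0) ![b']
        (by intro i hi; fin_cases i; exact hNof y b' hb' hi)
        (by intro i; fin_cases i; exact ⟨-e, hey, hy⟩)
        (by
          intro a ha i
          fin_cases i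
          simpa using ha)
        b
    refine ⟨ℓ, hbℓ, hPℓ, fun v hv ↦ ⟨?_, ?_⟩⟩
    · show addOrderOf (loc v x) = addOrderOf x
      rw [hx0, map_zero, addOrderOf_zero, addOrderOf_zero]
    · exact hconv v y b' hb' (by simpa using hordloc 0 v hv)
  · -- the system `(x, y)`
    obtain ⟨a', -, ha'⟩ := hordpow x
    obtain ⟨ℓ, hbℓ, hPℓ, hordloc⟩ := hsys ![x, y]
        (by
          intro i
          fin_cases i
          · exact hx0
          · exact hy0)
        ![a', b']
        (by
          intro i hi
          fin_cases i
          · exact hNof x a' ha' hi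
          · exact hNof y b' hb' hi)
        (by
          intro i
          fin_cases i
          · exact ⟨e, he, hx⟩
          · exact ⟨-e, hey, hy⟩)
        (by
          intro c hc i
          have hc' : c 0 • x + c 1 • y = 0 := by simpa [Fin.sum_univ_two] using hc
          obtain ⟨h0, h1⟩ := JET.dvd_of_zsmul_add_zsmul_eq_zero_of_eigen
            (conjAct W τ ((p ^ k : ℕ) : ℤ)) he hx hy (hcop2 x) (hcop2 y) hc'
          fin_cases i
          · simpa using addOrderOf_dvd_iff_zsmul_eq_zero.mp h0
          · simpa using addOrderOf_dvd_iff_zsmul_eq_zero.mp h1)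
        b
    refine ⟨ℓ, hbℓ, hPℓ, fun v hv ↦ ⟨?_, ?_⟩⟩
    · exact hconv v x a' ha' (by simpa using hordloc 0 v hv)
    · exact hconv v y b' hb' (by simpa using hordloc 1 v hv)

/-! ### §2 Kernel instances with Gross's depth kept -/

/-- **[J] Lemma 5.1 decoupled, GROSS currency, `ρ̄_{E,p}` ONTO**: for `τ ≠ 1`, `k ≥ 1`, a shift `j`, eigenclasses `x` (sign `e`) and
`y ≠ 0` (sign `−e`) in `H¹(K, E[p^k])` and any bound `b`: a prime `ℓ > b` with `IsKolyvaginPrime N W K p ℓ` and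
`FrobEqFrobInfty W K (p^{k+j}) ℓ` whose localisation preserves the orders of `x` and `y` (tam3-p1's wrapper with the Frobenius
class KEPT). UNCONDITIONAL. [cite: Jetchev2008, Lemma 5.1 (p. 821)] [cite: McCallumLMS1991, §3 Cor. 3.2, §4 Lemma 4.6] [cite: GrossLMS1991, §3 (3.2)] -/
theorem exists_grossKolyvaginPrime_addOrderOf_localization_eq_shift {N : ℕ} [NeZero N]
    (hK : IsImaginaryQuadratic K) {p : ℕ} [Fact p.Prime] (hp2 : p ≠ 2)
    (hρ : W.HasSurjectiveModNGaloisRep p) (τ : K ≃ₐ[ℚ] K) (hτ : τ ≠ 1) {k : ℕ} (hk : 1 ≤ k) (j : ℕ)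
    {e : ℤ} (he : e = 1 ∨ e = -1)
    (x y : galH1Torsion (W.baseChange K) ((p ^ k : ℕ) : ℤ))
    (hx : conjAct W τ ((p ^ k : ℕ) : ℤ) x = e • x) (hy : conjAct W τ ((p ^ k : ℕ) : ℤ) y = (-e) • y)
    (hy0 : y ≠ 0) (b : ℕ) :
    ∃ ℓ : ℕ, b < ℓ ∧ (IsKolyvaginPrime N W K p ℓ ∧ FrobEqFrobInfty W K (p ^ (k + j)) ℓ) ∧
      ∀ v : HeightOneSpectrum (𝓞 K), (ℓ : 𝓞 K) ∈ v.asIdeal →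
        addOrderOf (galoisCohomology.localization
            ((W.baseChange K).torsionGaloisModule ((p ^ k : ℕ) : ℤ)) (Sum.inr v) 1 x) = addOrderOf x ∧
        addOrderOf (galoisCohomology.localization
            ((W.baseChange K).torsionGaloisModule ((p ^ k : ℕ) : ℤ)) (Sum.inr v) 1 y) = addOrderOf y :=
  exists_prime_addOrderOf_localization_eq_of_systemSupply W hp2 τ
    (fun ℓ ↦ IsKolyvaginPrime N W K p ℓ ∧ FrobEqFrobInfty W K (p ^ (k + j)) ℓ)
    (fun cs h0 Nv hN hτ' hind b' ↦ by
      obtain ⟨ℓ, hbℓ, hKol, hfrob, hord⟩ := McCallum1991_cor_3_2_pow_shift_of_chebotarev (N := N) (W := W)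
        Literature.NumberTheory.Automorphic.chebotarev_artinRep_holds hK Fact.out hp2 hρ (exists_weilPairing_holds W p) hk j hτ
        cs h0 Nv hN hτ' hind b'
      exact ⟨ℓ, hbℓ, ⟨hKol, hfrob⟩, hord⟩)
    he x y hx hy hy0 b

/-- **[J] Lemma 5.1 decoupled, GROSS currency, `E[p]` IRREDUCIBLE with `−1 ∈ ρ̄(Γ_ℚ)`** and Gross's disjointness prime `q ∣ d_K`,
`q ∤ N`, `q ≠ p`: as above (this seat g7's wrapper with the Frobenius class KEPT). UNCONDITIONAL.
[cite: Jetchev2008, Lemma 5.1 (p. 821), Rem. 6.2] [cite: McCallumLMS1991, §3 Cor. 3.2] [cite: MatarNekovar2019, Prop. 5.26 (2)] -/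
theorem exists_grossKolyvaginPrime_addOrderOf_localization_eq_shift_of_irr_of_neg {N : ℕ} [NeZero N]
    (hN : W.conductorNorm ℤ = N) (hK : IsImaginaryQuadratic K) {p : ℕ} [Fact p.Prime] (hp2 : p ≠ 2)
    (hirr : W.HasIrreducibleModPGaloisRep p)
    (hneg : ∃ γ : Field.absoluteGaloisGroup ℚ, ∀ P : geomTorsion W p, γ • P = -P)
    {q : ℕ} (hq : q.Prime) (hqd : (q : ℤ) ∣ NumberField.discr K) (hqN : ¬ q ∣ N) (hqp : q ≠ p)
    (τ : K ≃ₐ[ℚ] K) (hτ : τ ≠ 1) {k : ℕ} (hk : 1 ≤ k) (j : ℕ)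
    {e : ℤ} (he : e = 1 ∨ e = -1)
    (x y : galH1Torsion (W.baseChange K) ((p ^ k : ℕ) : ℤ))
    (hx : conjAct W τ ((p ^ k : ℕ) : ℤ) x = e • x) (hy : conjAct W τ ((p ^ k : ℕ) : ℤ) y = (-e) • y)
    (hy0 : y ≠ 0) (b : ℕ) :
    ∃ ℓ : ℕ, b < ℓ ∧ (IsKolyvaginPrime N W K p ℓ ∧ FrobEqFrobInfty W K (p ^ (k + j)) ℓ) ∧
      ∀ v : HeightOneSpectrum (𝓞 K), (ℓ : 𝓞 K) ∈ v.asIdeal →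
        addOrderOf (galoisCohomology.localization
            ((W.baseChange K).torsionGaloisModule ((p ^ k : ℕ) : ℤ)) (Sum.inr v) 1 x) = addOrderOf x ∧
        addOrderOf (galoisCohomology.localization
            ((W.baseChange K).torsionGaloisModule ((p ^ k : ℕ) : ℤ)) (Sum.inr v) 1 y) = addOrderOf y :=
  exists_prime_addOrderOf_localization_eq_of_systemSupply W hp2 τ
    (fun ℓ ↦ IsKolyvaginPrime N W K p ℓ ∧ FrobEqFrobInfty W K (p ^ (k + j)) ℓ)
    (fun cs h0 Nv hNv hτ' hind b' ↦ by
      obtain ⟨ℓ, hbℓ, hKol, hfrob, hord⟩ := McCallum1991_cor_3_2_pow_shift_of_irr_of_neg (W := W) hN hK Fact.out hp2 hirr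
        hneg hq hqd hqN hqp hk j hτ cs h0 Nv hNv hτ' hind b'
      exact ⟨ℓ, hbℓ, ⟨hKol, hfrob⟩, hord⟩)
    he x y hx hy hy0 b

/-! ### §3 The binder `hceb` of file 5, discharged on the two image cells -/

/-- **File 5's Čebotarev binder `hceb` (level `p`, shift `1 + j`, every `τ ≠ 1`) for `ρ̄_{E,p}` ONTO.** UNCONDITIONAL.
[cite: Jetchev2008, Lemma 5.1 (p. 821)] [cite: McCallumLMS1991, §3 Cor. 3.2] -/
theorem hceb_family_of_surj {N : ℕ} [NeZero N] (hK : IsImaginaryQuadratic K) {p : ℕ} [Fact p.Prime] (hp2 : p ≠ 2)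
    (hρ : W.HasSurjectiveModNGaloisRep p) :
    ∀ (τ : K ≃ₐ[ℚ] K), τ ≠ 1 → ∀ (j : ℕ) (e₁ : ℤ), (e₁ = 1 ∨ e₁ = -1) →
      ∀ (x y : galoisCohomology ((W.baseChange K).torsionGaloisModule ((p ^ 1 : ℕ) : ℤ)) 1),
      conjAct W τ ((p ^ 1 : ℕ) : ℤ) x = e₁ • x → conjAct W τ ((p ^ 1 : ℕ) : ℤ) y = (-e₁) • y → y ≠ 0 →
      ∀ (b : ℕ), ∃ ℓ : ℕ, b < ℓ ∧ IsKolyvaginPrime N W K p ℓ ∧ FrobEqFrobInfty W K (p ^ (1 + j)) ℓ ∧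
        ∀ v : HeightOneSpectrum (𝓞 K), (ℓ : 𝓞 K) ∈ v.asIdeal →
          addOrderOf (galoisCohomology.localization
              ((W.baseChange K).torsionGaloisModule ((p ^ 1 : ℕ) : ℤ)) (Sum.inr v) 1 x) = addOrderOf x ∧
          addOrderOf (galoisCohomology.localization
              ((W.baseChange K).torsionGaloisModule ((p ^ 1 : ℕ) : ℤ)) (Sum.inr v) 1 y) = addOrderOf y := by
  intro τ hτ j e₁ he₁ x y hx hy hy0 b
  obtain ⟨ℓ, hbℓ, ⟨hKol, hfrob⟩, hord⟩ := exists_grossKolyvaginPrime_addOrderOf_localization_eq_shift W (N := N) hK hp2 hρ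
    τ hτ le_rfl j he₁ x y hx hy hy0 b
  exact ⟨ℓ, hbℓ, hKol, hfrob, hord⟩

/-- **File 5's Čebotarev binder `hceb` for `E[p]` IRREDUCIBLE with `−1 ∈ ρ̄(Γ_ℚ)`** and Gross's disjointness prime (for a Heegner
field any prime factor of `d_K`). UNCONDITIONAL. [cite: Jetchev2008, Lemma 5.1 (p. 821), Rem. 6.2] [cite: MatarNekovar2019, Prop. 5.26 (2)] -/
theorem hceb_family_of_irr_of_neg {N : ℕ} [NeZero N] (hN : W.conductorNorm ℤ = N) (hK : IsImaginaryQuadratic K)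
    {p : ℕ} [Fact p.Prime] (hp2 : p ≠ 2) (hirr : W.HasIrreducibleModPGaloisRep p)
    (hneg : ∃ γ : Field.absoluteGaloisGroup ℚ, ∀ P : geomTorsion W p, γ • P = -P)
    {q : ℕ} (hq : q.Prime) (hqd : (q : ℤ) ∣ NumberField.discr K) (hqN : ¬ q ∣ N) (hqp : q ≠ p) :
    ∀ (τ : K ≃ₐ[ℚ] K), τ ≠ 1 → ∀ (j : ℕ) (e₁ : ℤ), (e₁ = 1 ∨ e₁ = -1) →
      ∀ (x y : galoisCohomology ((W.baseChange K).torsionGaloisModule ((p ^ 1 : ℕ) : ℤ)) 1),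
      conjAct W τ ((p ^ 1 : ℕ) : ℤ) x = e₁ • x → conjAct W τ ((p ^ 1 : ℕ) : ℤ) y = (-e₁) • y → y ≠ 0 →
      ∀ (b : ℕ), ∃ ℓ : ℕ, b < ℓ ∧ IsKolyvaginPrime N W K p ℓ ∧ FrobEqFrobInfty W K (p ^ (1 + j)) ℓ ∧
        ∀ v : HeightOneSpectrum (𝓞 K), (ℓ : 𝓞 K) ∈ v.asIdeal →
          addOrderOf (galoisCohomology.localization
              ((W.baseChange K).torsionGaloisModule ((p ^ 1 : ℕ) : ℤ)) (Sum.inr v) 1 x) = addOrderOf x ∧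
          addOrderOf (galoisCohomology.localization
              ((W.baseChange K).torsionGaloisModule ((p ^ 1 : ℕ) : ℤ)) (Sum.inr v) 1 y) = addOrderOf y := by
  intro τ hτ j e₁ he₁ x y hx hy hy0 b
  obtain ⟨ℓ, hbℓ, ⟨hKol, hfrob⟩, hord⟩ := exists_grossKolyvaginPrime_addOrderOf_localization_eq_shift_of_irr_of_neg W hN hK
    hp2 hirr hneg hq hqd hqN hqp τ hτ le_rfl j he₁ x y hx hy hy0 b
  exact ⟨ℓ, hbℓ, hKol, hfrob, hord⟩

/-! ### §4 (appended, g15) IMAGE-KEYED instance and the INERT-`3` irreducible frames of cruxes 21420 ∕ 19109 -/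

/-- **[J] Lemma 5.1 decoupled, GROSS currency, for EVERY image delivering the four inputs** (`hIz` : `−1 ∈ ρ̄(Γ_K)`, `hIs` :
`E[p]|_{Γ_K}` irreducible, `hIc` : scalar `Γ_K`-commutant, `hIt` : `E(K)[p] = 0`) — §1 fed with corner3-p2's image-keyed level-shift
kernel `ShimuraKolyvaginOfImage.McCallum1991_cor_3_2_pow_shift_of_chebotarev_ofImage` (Čebotarev and the Weil pairing are tree theorems).
UNCONDITIONAL given the four inputs. [cite: Jetchev2008, Lemma 5.1 (p. 821)] [cite: McCallumLMS1991, §3 Cor. 3.2, §4 Lemma 4.6]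
[cite: MatarNekovar2019, Prop. 5.26 (2)] -/
theorem exists_grossKolyvaginPrime_addOrderOf_localization_eq_shift_ofImage {N : ℕ} [NeZero N]
    (hK : IsImaginaryQuadratic K) {p : ℕ} [Fact p.Prime] (hp2 : p ≠ 2)
    (hIz : ∃ z : Field.absoluteGaloisGroup K, ∀ t : geomTorsion (W.baseChange K) p, z • t = -t)
    (hIs : (W.baseChange K).HasIrreducibleModPGaloisRep p)
    (hIc : ∀ f : geomTorsion (W.baseChange K) p →+ geomTorsion (W.baseChange K) p,
      (∀ (g : Field.absoluteGaloisGroup K) (t : geomTorsion (W.baseChange K) p), f (g • t) = g • f t) →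
        ∃ k : ℤ, ∀ t, f t = k • t)
    (hIt : AddSubgroup.torsionBy (W.baseChange K).toAffine.Point (p : ℤ) = ⊥)
    (τ : K ≃ₐ[ℚ] K) (hτ : τ ≠ 1) {k : ℕ} (hk : 1 ≤ k) (j : ℕ)
    {e : ℤ} (he : e = 1 ∨ e = -1)
    (x y : galH1Torsion (W.baseChange K) ((p ^ k : ℕ) : ℤ))
    (hx : conjAct W τ ((p ^ k : ℕ) : ℤ) x = e • x) (hy : conjAct W τ ((p ^ k : ℕ) : ℤ) y = (-e) • y)
    (hy0 : y ≠ 0) (b : ℕ) :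
    ∃ ℓ : ℕ, b < ℓ ∧ (IsKolyvaginPrime N W K p ℓ ∧ FrobEqFrobInfty W K (p ^ (k + j)) ℓ) ∧
      ∀ v : HeightOneSpectrum (𝓞 K), (ℓ : 𝓞 K) ∈ v.asIdeal →
        addOrderOf (galoisCohomology.localization
            ((W.baseChange K).torsionGaloisModule ((p ^ k : ℕ) : ℤ)) (Sum.inr v) 1 x) = addOrderOf x ∧
        addOrderOf (galoisCohomology.localization
            ((W.baseChange K).torsionGaloisModule ((p ^ k : ℕ) : ℤ)) (Sum.inr v) 1 y) = addOrderOf y :=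
  exists_prime_addOrderOf_localization_eq_of_systemSupply W hp2 τ
    (fun ℓ ↦ IsKolyvaginPrime N W K p ℓ ∧ FrobEqFrobInfty W K (p ^ (k + j)) ℓ)
    (fun cs h0 Nv hNv hτ' hind b' ↦ by
      obtain ⟨ℓ, hbℓ, hKol, hfrob, hord⟩ :=
        ShimuraKolyvaginOfImage.McCallum1991_cor_3_2_pow_shift_of_chebotarev_ofImage (N := N) (W := W)
          Literature.NumberTheory.Automorphic.chebotarev_artinRep_holds hK Fact.out hp2 hIz hIs hIc hIt
          (exists_weilPairing_holds W p) hk j hτ cs h0 Nv hNv hτ' hind b'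
      exact ⟨ℓ, hbℓ, ⟨hKol, hfrob⟩, hord⟩)
    he x y hx hy hy0 b

/-- **File 5's Čebotarev binder `hceb` for EVERY image delivering the four inputs** (level `p`, shift `1 + j`, every `τ ≠ 1`).
UNCONDITIONAL given the inputs. [cite: Jetchev2008, Lemma 5.1 (p. 821)] [cite: McCallumLMS1991, §3 Cor. 3.2] -/
theorem hceb_family_ofImage {N : ℕ} [NeZero N] (hK : IsImaginaryQuadratic K) {p : ℕ} [Fact p.Prime] (hp2 : p ≠ 2)
    (hIz : ∃ z : Field.absoluteGaloisGroup K, ∀ t : geomTorsion (W.baseChange K) p, z • t = -t)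
    (hIs : (W.baseChange K).HasIrreducibleModPGaloisRep p)
    (hIc : ∀ f : geomTorsion (W.baseChange K) p →+ geomTorsion (W.baseChange K) p,
      (∀ (g : Field.absoluteGaloisGroup K) (t : geomTorsion (W.baseChange K) p), f (g • t) = g • f t) →
        ∃ k : ℤ, ∀ t, f t = k • t)
    (hIt : AddSubgroup.torsionBy (W.baseChange K).toAffine.Point (p : ℤ) = ⊥) :
    ∀ (τ : K ≃ₐ[ℚ] K), τ ≠ 1 → ∀ (j : ℕ) (e₁ : ℤ), (e₁ = 1 ∨ e₁ = -1) →
      ∀ (x y : galoisCohomology ((W.baseChange K).torsionGaloisModule ((p ^ 1 : ℕ) : ℤ)) 1),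
      conjAct W τ ((p ^ 1 : ℕ) : ℤ) x = e₁ • x → conjAct W τ ((p ^ 1 : ℕ) : ℤ) y = (-e₁) • y → y ≠ 0 →
      ∀ (b : ℕ), ∃ ℓ : ℕ, b < ℓ ∧ IsKolyvaginPrime N W K p ℓ ∧ FrobEqFrobInfty W K (p ^ (1 + j)) ℓ ∧
        ∀ v : HeightOneSpectrum (𝓞 K), (ℓ : 𝓞 K) ∈ v.asIdeal →
          addOrderOf (galoisCohomology.localization
              ((W.baseChange K).torsionGaloisModule ((p ^ 1 : ℕ) : ℤ)) (Sum.inr v) 1 x) = addOrderOf x ∧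
          addOrderOf (galoisCohomology.localization
              ((W.baseChange K).torsionGaloisModule ((p ^ 1 : ℕ) : ℤ)) (Sum.inr v) 1 y) = addOrderOf y := by
  intro τ hτ j e₁ he₁ x y hx hy hy0 b
  obtain ⟨ℓ, hbℓ, ⟨hKol, hfrob⟩, hord⟩ := exists_grossKolyvaginPrime_addOrderOf_localization_eq_shift_ofImage W (N := N)
    hK hp2 hIz hIs hIc hIt τ hτ le_rfl j he₁ x y hx hy hy0 b
  exact ⟨ℓ, hbℓ, hKol, hfrob, hord⟩

/-- **File 5's Čebotarev binder `hceb` on the carrier-INERT Shimura frames at `3` of cruxes 21420 ∕ 19109** (`E[3]` irreducible, onto or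
NOT; `K` imaginary quadratic; `S` the inert-unramified level primes with `3 ∈ S`; every other prime of `N = N_E` split) — the four image
inputs from corner3-p2's `ShimuraKolyvaginOfImage.kolyvaginImageInputs_three_of_mem_inertSet` (Gross's disjointness prime `q ∣ d_K`).
UNCONDITIONAL. [cite: McCallumLMS1991, §3 Cor. 3.2] [cite: MatarNekovar2019, Prop. 5.26 (2)] [cite: GrossLMS1991, §3 (3.2)] -/
theorem hceb_family_three_of_mem_inertSet [Fact (Nat.Prime 3)] {N : ℕ} [NeZero N] (S : Finset ℕ)
    (hN : W.conductorNorm ℤ = N) (hirr : W.HasIrreducibleModPGaloisRep 3) (hK : IsImaginaryQuadratic K)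
    (hS : ∀ ℓ ∈ S, ℓ.Prime ∧ ℓ ∣ N ∧ ¬ ℓ ^ 2 ∣ N ∧
      ((Ideal.span {(ℓ : ℤ)}).primesOver (𝓞 K)).ncard = 1 ∧ ¬ (ℓ : ℤ) ∣ NumberField.discr K)
    (hsplit : ∀ ℓ : ℕ, ℓ.Prime → ℓ ∣ N → ℓ ∉ S →
      ((Ideal.span {(ℓ : ℤ)}).primesOver (𝓞 K)).ncard = 2)
    (h3S : 3 ∈ S) :
    ∀ (τ : K ≃ₐ[ℚ] K), τ ≠ 1 → ∀ (j : ℕ) (e₁ : ℤ), (e₁ = 1 ∨ e₁ = -1) →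
      ∀ (x y : galoisCohomology ((W.baseChange K).torsionGaloisModule ((3 ^ 1 : ℕ) : ℤ)) 1),
      conjAct W τ ((3 ^ 1 : ℕ) : ℤ) x = e₁ • x → conjAct W τ ((3 ^ 1 : ℕ) : ℤ) y = (-e₁) • y → y ≠ 0 →
      ∀ (b : ℕ), ∃ ℓ : ℕ, b < ℓ ∧ IsKolyvaginPrime N W K 3 ℓ ∧ FrobEqFrobInfty W K (3 ^ (1 + j)) ℓ ∧
        ∀ v : HeightOneSpectrum (𝓞 K), (ℓ : 𝓞 K) ∈ v.asIdeal →
          addOrderOf (galoisCohomology.localization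
              ((W.baseChange K).torsionGaloisModule ((3 ^ 1 : ℕ) : ℤ)) (Sum.inr v) 1 x) = addOrderOf x ∧
          addOrderOf (galoisCohomology.localization
              ((W.baseChange K).torsionGaloisModule ((3 ^ 1 : ℕ) : ℤ)) (Sum.inr v) 1 y) = addOrderOf y := by
  obtain ⟨hIz, hIs, hIc, hIt⟩ :=
    ShimuraKolyvaginOfImage.kolyvaginImageInputs_three_of_mem_inertSet K W S hN hirr hK hS hsplit h3S
  exact hceb_family_ofImage W (N := N) hK (by decide) hIz hIs hIc hIt

end Summit.BirchSwinnertonDyer.Rank1Residual.X11b.Three.Koly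

end
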